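import Mathlib
import Summits.RiemannHypothesis.RiemannHypothesis.Theorems.SoloInformedScrewVerified
import Summits.RiemannHypothesis.RiemannHypothesis.Theorems.SoloInformedDensityExplicit
import HarnessLib

/-!
# T43′ — the explicit Platt–Trudgian/HSW instance of T43

With the unit-window constant `C₀ = 20` supplied by the Hasanalizade–Shen–Wong counting bound
(`zetaZeroCount_add_one_sub_le_of_hsw`, extended here to all real `u`) and
`RHUpTo 3 000 175 332 800` from `platt_trudgian_numerical_rh`, T43 (`zetaScrew_ge_neg_of_rhUpTo`)
reads, with every hypothesis a NAMED Literature fact: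

  `Ψ(t) ≥ −1280·(1 + cosh(t/2))·log(T₀ + 2)/(T₀ + 1)`,  `T₀ = 3 000 175 332 800`,

and in particular (`zetaScrew_ge_neg_hundredth`) `Ψ(t) ≥ −1/100` for `|t| ≤ 26` (primes up to
`e^{26}`): the single-log exchange rate of T43 evaluated. (Under RH,
`0 ≤ Ψ ≤ 4·Σ_{γ>0} γ⁻² ≈ 0.092`, so `10⁻²` is below the natural scale of `Ψ`.)
-/

noncomputable section

open scoped Real
open Literature.NumberTheory.LFunctions

namespace Summit.RiemannHypothesis.RiemannHypothesis.Theorems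

/-- The HSW unit-window bound for every real `u` (below height `0` there are no zeros). -/
theorem zetaZeroCount_window_le_twenty (h : zetaZeroCount_hasanalizade_shen_wong) (u : ℝ) :
    (zetaZeroCount (u + 1) : ℝ) - zetaZeroCount u ≤ 20 * Real.log (|u| + 2) := by
  rcases le_or_gt 0 u with hu | hu
  · rw [abs_of_nonneg hu]; exact zetaZeroCount_add_one_sub_le_of_hsw h hu
  · -- `u < 0`: `N(u) = 0` and `N(u+1) ≤ N(1) ≤ 20 log 2 ≤ 20 log (|u|+2)`
    have h0 : zetaZeroCount u = 0 := zetaZeroCount_eq_zero_of_nonpos hu.le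
    have h1 : (zetaZeroCount (u + 1) : ℝ) ≤ zetaZeroCount 1 := by
      exact_mod_cast zetaZeroCount_mono (by linarith : u + 1 ≤ 1)
    have h2 : (zetaZeroCount (0 + 1) : ℝ) - zetaZeroCount 0 ≤ 20 * Real.log (0 + 2) :=
      zetaZeroCount_add_one_sub_le_of_hsw h le_rfl
    rw [zetaZeroCount_eq_zero_of_nonpos le_rfl, zero_add, zero_add] at h2
    rw [h0]
    simp only [Nat.cast_zero, sub_zero] at h2 ⊢
    have h3 : Real.log 2 ≤ Real.log (|u| + 2) :=
      Real.log_le_log (by norm_num) (by linarith [abs_nonneg u])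
    linarith

/-- **T43′ (explicit instance).** Under `platt_trudgian_numerical_rh`, the HSW counting bound and
Suzuki's series: `Ψ(t) ≥ −1280·(1 + cosh(t/2))·log(T₀+2)/(T₀+1)`, `T₀ = 3000175332800`. -/
theorem zetaScrew_ge_neg_explicit (hS : Suzuki2023_thm11_series) (hPT : platt_trudgian_numerical_rh)
    (hH : zetaZeroCount_hasanalizade_shen_wong) (t : ℝ) :
    -(1280 * (1 + Real.cosh (t / 2)) * Real.log (3000175332800 + 2) / (3000175332800 + 1))
      ≤ zetaScrew t := by
  have h := zetaScrew_ge_neg_of_platt_trudgian hS hPT (by norm_num : (0 : ℝ) ≤ 20)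
    (zetaZeroCount_window_le_twenty hH) t
  convert h using 2; ring

/-- **T43′, evaluated: `Ψ(t) ≥ −1/100` for `|t| ≤ 26`** (same three named facts). -/
theorem zetaScrew_ge_neg_hundredth (hS : Suzuki2023_thm11_series)
    (hPT : platt_trudgian_numerical_rh) (hH : zetaZeroCount_hasanalizade_shen_wong) {t : ℝ}
    (ht : |t| ≤ 26) : -(1 / 100 : ℝ) ≤ zetaScrew t := by
  have h := zetaScrew_ge_neg_explicit hS hPT hH t
  -- `cosh(t/2) ≤ cosh 13 ≤ e^{13} ≤ 2^{19}`; `log(T₀+2) ≤ 29` since `T₀ + 2 ≤ e^{29}`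
  have hcosh : Real.cosh (t / 2) ≤ 2 ^ 19 := by
    have h1 : Real.cosh (t / 2) ≤ Real.cosh 13 := by
      rw [Real.cosh_le_cosh, abs_div, abs_two]
      have : |(13 : ℝ)| = 13 := abs_of_nonneg (by norm_num)
      rw [this]; linarith
    have h2 : Real.cosh 13 ≤ Real.exp 13 := by
      rw [Real.cosh_eq]
      have : Real.exp (-13) ≤ Real.exp 13 := Real.exp_le_exp.2 (by norm_num)
      linarith
    have h3 : Real.exp 13 ≤ 2 ^ 19 := by
      have he : Real.exp 1 < 2.7182818286 := Real.exp_one_lt_d9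
      have : Real.exp 13 = Real.exp 1 ^ 13 := by
        rw [Real.exp_one_pow 13]; norm_num
      rw [this]
      calc Real.exp 1 ^ 13 ≤ (2.7182818286 : ℝ) ^ 13 := by
            gcongr
        _ ≤ 2 ^ 19 := by norm_num
    linarith
  have hlog : Real.log (3000175332800 + 2) ≤ 29 := by
    have he0 : (2.7182818283 : ℝ) < Real.exp 1 := Real.exp_one_gt_d9
    have h1 : (3000175332800 + 2 : ℝ) ≤ Real.exp 29 := by
      have : Real.exp 29 = Real.exp 1 ^ 29 := by
        rw [Real.exp_one_pow 29]; norm_num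
      rw [this]
      calc (3000175332800 + 2 : ℝ) ≤ (2.7182818283 : ℝ) ^ 29 := by norm_num
        _ ≤ Real.exp 1 ^ 29 := by gcongr
    calc Real.log (3000175332800 + 2) ≤ Real.log (Real.exp 29) :=
          Real.log_le_log (by norm_num) h1
      _ = 29 := Real.log_exp 29
  have hK : 0 ≤ 1 + Real.cosh (t / 2) := by positivity
  have hb : 1280 * (1 + Real.cosh (t / 2)) * Real.log (3000175332800 + 2) / (3000175332800 + 1)
      ≤ 1 / 100 := by
    rw [div_le_iff₀ (by norm_num)]
    have hlog0 : 0 ≤ Real.log (3000175332800 + 2) := Real.log_nonneg (by norm_num)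
    calc 1280 * (1 + Real.cosh (t / 2)) * Real.log (3000175332800 + 2)
        ≤ 1280 * (1 + 2 ^ 19) * 29 := by gcongr
      _ ≤ 1 / 100 * (3000175332800 + 1) := by norm_num
  linarith

end Summit.RiemannHypothesis.RiemannHypothesis.Theorems
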